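import Summits.BirchSwinnertonDyer.BirchSwinnertonDyer.Theorems.GenusKolyvaginAtTwoTorsionCellSELIsoClassLawC1
import Summits.BirchSwinnertonDyer.BirchSwinnertonDyer.Theorems.GenusKolyvaginAtTwoTorsionCellSELPhi3KernelParity
import HarnessLib

/-!
# SEL corollary: the 2-Selmer PARITIES of an iso-class genus pair (`dim Sel₂(C₀)` even, `dim Sel₂(C₁)` odd), unconditionally

Crux R″ `RankOneTwoTorsionResidualAtTwo` (stmt-27478), LINE 49 «torsion_cell_full_vertex_bsdidea1» §2 SEL («PARITY built in»).
From the iso-class Selmer pair law (`isoClassSelmerPairLaw_unfolded`: `#Sel₂(C₀) = 4·#ker Φ₃(Ĝ)`, `#Sel₂(C₁) = 8·#ker Φ₃(B)`) and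
`#ker Φ₃(A) = 4^j` (`natCard_ker_phi3_eq_four_pow`): **`#Sel₂(C₀) = 4^{j₀+1}` and `#Sel₂(C₁) = 2·4^{j₁+1}`** — the Selmer parities of
the rank-`0` / rank-`1` members of the genus pair `(E₀^{(M₀)}, E₀^{(−p₀M₀)})`, with no root-number or parity-conjecture input
(line defs unfolded verbatim, as in `…SELIsoClassLawC1`).

Everything is proved; no LINE 49 statement is restated; BSD is not advanced by this file alone.

## References

* [KlagsbrunMazurRubin2013] Z. Klagsbrun, B. Mazur, K. Rubin, Ann. of Math. 178 (2013), Thm. 3.9.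
* [HeathBrown1994SelmerCongruentII] D. R. Heath-Brown, Invent. Math. 118 (1994), §2.
* [ShuZhai2021] J. Shu, S. Zhai, Trans. AMS 374 (2021), Def. 1.1, Thm. 1.2.
-/

noncomputable section

open scoped Classical

namespace Summit.BirchSwinnertonDyer.BirchSwinnertonDyer.Theorems.GenusKolyvaginAtTwo.TorsionCellSEL

open WeierstrassCurve WeierstrassCurve.Affine WeierstrassCurve.Affine.Point
open Literature.NumberTheory.GaloisRepresentations Literature.NumberTheory.EllipticCurves Field
open Literature.NumberTheory.EllipticCurves.ShuZhai2021 (qStar IsInertInSqrt AllPrimesSplitInSqrt IsOptimalDatum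
  CuspZeroNotInTwice)
open Literature.NumberTheory.EllipticCurves.ModularForms (ModularParametrizationData)
open Summit.BirchSwinnertonDyer.BirchSwinnertonDyer.Theorems.GenusKolyvaginAtTwo.FullVertex
open Matrix

/-- **SELMER PARITIES OF THE GENUS PAIR** (see the module docstring). [cite: KlagsbrunMazurRubin2013, Thm. 3.9]
[cite: HeathBrown1994SelmerCongruentII, §2] [cite: ShuZhai2021, Def. 1.1, Thm. 1.2] -/
theorem natCard_selmerGroup_genusPair_parity [inst : DecidableEq ℚ]
    (E₀ : WeierstrassCurve ℚ) [E₀.IsElliptic] [E₀.IsGloballyMinimal] [NeZero (E₀.conductorNorm ℤ)]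
    (Dt : ModularParametrizationData E₀ (E₀.conductorNorm ℤ)) (p₀ : ℕ) (Q₀ : Finset ℕ)
    (C₀ : WeierstrassCurve ℚ) [C₀.IsElliptic] (C₁ : WeierstrassCurve ℚ) [C₁.IsElliptic]
    (hB : (∃ P Q : E₀.toAffine.Point, P ≠ Q ∧ P ≠ 0 ∧ Q ≠ 0 ∧ 2 • P = 0 ∧ 2 • Q = 0) ∧
      (∀ x ∈ E₀.sha, (2 : ℕ) • x = 0 → x = 0) ∧ IsOptimalDatum E₀ Dt ∧ ¬ (2 : ℤ) ∣ Dt.c ∧ CuspZeroNotInTwice E₀ Dt ∧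
      p₀.Prime ∧ 3 < p₀ ∧ p₀ % 8 = 7 ∧ AllPrimesSplitInSqrt (2 * E₀.conductorNorm ℤ) (-(p₀ : ℤ)) ∧
      (∀ q ∈ Q₀, (q.Prime ∧ Nat.Coprime q (2 * E₀.conductorNorm ℤ) ∧
        ∀ (V' : WeierstrassCurve ℚ) [V'.IsElliptic], (∃ φ : Isogeny E₀ V', φ.degree = 2) → IsInertInSqrt q V'.Δ) ∧
          q ≠ p₀) ∧
      0 < (∏ q ∈ Q₀, qStar q) ∧ AllPrimesSplitInSqrt (2 * E₀.conductorNorm ℤ) (∏ q ∈ Q₀, qStar q))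
    (hmw₀ : E₀.mordellWeilRank = 0) (hiso : IsIsoClass (E₀.conductorNorm ℤ) Q₀)
    (hpair : (∃ T : VariableChange ℚ, T • E₀.quadraticTwist ((∏ q ∈ Q₀, qStar q : ℤ) : ℚ) = C₀) ∧
      (∃ T : VariableChange ℚ, T • E₀.quadraticTwist ((-(p₀ : ℤ) * ∏ q ∈ Q₀, qStar q : ℤ) : ℚ) = C₁)) :
    (∃ j : ℕ, Nat.card (C₀.selmerGroup ((2 : ℕ) : ℤ)) = 4 ^ (j + 1)) ∧
      (∃ j : ℕ, Nat.card (C₁.selmerGroup ((2 : ℕ) : ℤ)) = 2 * 4 ^ (j + 1)) := by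
  obtain ⟨⟨-, hs₀⟩, ⟨-, hs₁⟩⟩ := isoClassSelmerPairLaw_unfolded (inst := inst) E₀ Dt p₀ Q₀ C₀ C₁ hB hmw₀ hiso hpair
  refine ⟨⟨Module.finrank (ZMod 2) (LinearMap.ker (phi3 (redeiLaplacian Q₀)).mulVecLin) / 2, ?_⟩,
    ⟨Module.finrank (ZMod 2) (LinearMap.ker (phi3 (borderedLaplacian Q₀ p₀)).mulVecLin) / 2, ?_⟩⟩
  · rw [hs₀, natCard_ker_phi3_eq_four_pow, pow_succ]; ring
  · rw [hs₁, natCard_ker_phi3_eq_four_pow, pow_succ]; ring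

end Summit.BirchSwinnertonDyer.BirchSwinnertonDyer.Theorems.GenusKolyvaginAtTwo.TorsionCellSEL

end
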